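import Literature.MathematicalPhysics.QuantumFieldTheory.Balaban1983to89.T3AlphaInputsAC
import HarnessLib

/-!
# `Balaban1983to89.T3AlphaPolymerSocket` — rung R3, crux «FluctuationComparisonRegPr» (stmt-QuantumFields-19201), stub 3b `stub_cauchyOfLocalRep`:
# the cut-off-Cauchy property of the pinned interaction data resolved POLYMER BY POLYMER — matched localisation domains across two consecutive
# cut-offs and the per-polymer comparison schema ([King1986] §3.4 «replacing one by one every factor», read for Bałaban's localised terms (43))

Fleet seat `ym-ust-19201-p2` (gen 0); MEMO-19201-SE-anatomy v3 (evidence on stmt-QuantumFields-19201) «ladder of record»: stub 3 ⇐ (3a) ∃ good D ∧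
`RepAtHeights` + (3b) ∀ good D, Rep → `CauchyAtHeights` ⇐ `LevelCauchyAt (levelData D)` (p456396) ⇐ THIS RUNG: `PolymerCauchyAt D` + `LocMatched D` (+
`LocCover`).  WHAT THIS IS NOT: nothing is asserted; §1 are plumbing definitions (the refinement of point sets across the two towers), §2 are
hypothesis SCHEMAS over the interface's EXPOSED data (`Loc`, `Pterm`, `Umin`), to be discharged by whoever constructs the data (`LocMatched`: print's
localisation domains are geometric — unions of big blocks of `T^{(i)}`, (24) p.262 — hence the SAME family at the same PHYSICAL scale in the runs
with cut-offs `L^{−K}` and `L^{−K−1}`) resp. proved as the located two-cut-off analysis (`PolymerCauchyAt` = e1–e3 of the memo: [King1986] Props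
3.8–3.9 pp.664–665 + §3.4–3.5 for Bałaban's activities — unprinted for non-abelian d = 3).

* §1 `coarsenSite F K : Site (F.P (K+1)) 0 → Site (F.P K) 0` (block map to level 1 of run `K+1`, then the level identification `(F.P (K+1))₁ ≃ (F.P K)₀`
  of `T3LevelShift`), `refineSet F K Y := coarsenSite ⁻¹' Y` (a point set of run `K`'s fine torus read as the union of the corresponding cubes of run
  `K+1`'s fine torus — the same physical region).
* §2 `LocMatched D` (at the trivial history, run `K+1`'s level-`(i+1)` localisation domains at height `n` ARE the refinements of run `K`'s level-`i` ones),
  `PolymerCauchyAt D b₀ p₀ m` (per-polymer matched comparison of `Pterm` at the two runs' trivial-history composite minimisers with budgets `η K j Y ≥ 0`,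
  plus the extra-finest-slice budget `δ₀ K` at level granularity, plus summability of the level sums along `n = ⌊K/m⌋`).
The bookkeeping «`PintDecomp D → LocMatched D → PolymerCauchyAt D b₀ p₀ m → LevelCauchyAt F γ b₀ p₀ m (levelData D)`» is summit-side
(`Summit.….LogComparisonSocketPolymers.levelCauchyAt_of_polymerwise`).

References: T. Bałaban, CMP 102 (1985) 255–275 [Balaban1985UV3] ((24)–(25) p.262, (43) p.266); C. King, CMP 102 (1986) 649–677 [King1986] (Thm 3.4
(3.9) p.656, Props 3.8–3.9 pp.664–665).
-/

noncomputable section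

open MeasureTheory
open Literature.MathematicalPhysics.QuantumFieldTheory.Balaban1983to89.T3ContinuumYM3Torus
open Literature.MathematicalPhysics.QuantumFieldTheory.Balaban1983to89.T3UnitLawDensityEML (ℰp measurableE_ℰp)
open Literature.MathematicalPhysics.QuantumFieldTheory.Balaban1983to89.T3UnitScaleTilt
open Literature.MathematicalPhysics.QuantumFieldTheory.Balaban1983to89.T3TiltDescent
open Literature.MathematicalPhysics.QuantumFieldTheory.Balaban1983to89.T3LevelShift
open Literature.MathematicalPhysics.QuantumFieldTheory.Balaban1983to89.T3AlphaInputsAC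

namespace Literature.MathematicalPhysics.QuantumFieldTheory.Balaban1983to89.T3AlphaPolymerSocket

/-! ## §1 Point sets across the two towers -/

section Geometry

variable (F : T3Family) (K : ℕ)

/-- **THE COARSENING MAP ACROSS THE TWO CUT-OFFS**: a site of run `K+1`'s finest torus (spacing `L^{−K−1}`) ↦ the site of run `K`'s finest torus (spacing
`L^{−K}`) whose cube contains it — the block map of [Balaban1987RG1] (0.1) to level 1 of run `K+1`, then the level identification `(F.P (K+1))₁ ≃ (F.P K)₀`.
[cite: Balaban1987RG1, (0.1) p.251] -/
def coarsenSite (x : Site (F.P (K + 1)) 0) : Site (F.P K) 0 :=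
  (siteShift (F.sitesPerDir_eq (m := F.m) (K := K) (j := 0) (m' := F.m) (K' := K + 1) (j' := 1) (by omega))).symm (blockOf x)

/-- **THE SAME PHYSICAL REGION ONE CUT-OFF FINER**: a point set of run `K`'s finest torus read as the union of the corresponding `L³`-cubes of run `K+1`'s
finest torus. [cite: Balaban1987RG1, (0.1) p.251] -/
def refineSet (Y : Set (Site (F.P K) 0)) : Set (Site (F.P (K + 1)) 0) :=
  coarsenSite F K ⁻¹' Y

/-- Membership in the refined set (definitional). [cite: Balaban1987RG1, (0.1) p.251] -/
theorem mem_refineSet_iff (Y : Set (Site (F.P K) 0)) (x : Site (F.P (K + 1)) 0) : x ∈ refineSet F K Y ↔ coarsenSite F K x ∈ Y :=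
  Iff.rfl

end Geometry

/-! ## §2 The polymer-level sockets (hypothesis schemas over the interface's exposed data; never asserted) -/

section Schemas

variable {F : T3Family} {γ : ℝ} (D : AlphaDataT3 F γ) (b₀ p₀ : ℝ)

/-- **MATCHED LOCALISATION DOMAINS ACROSS THE TWO CUT-OFFS** (hypothesis schema on the exposed data `Loc`, never asserted): at the trivial history and
every comparison height `n ≤ K`, refinement is a bijection from run `K`'s level-`i` localisation domains (`1 ≤ i ≤ K − n`) onto run `K+1`'s
level-`(i+1)` ones — [Balaban1985UV3] (24) p.262 «localizations X are connected unions of big blocks», a GEOMETRIC family determined by the physical scale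
`L^{i−K} = L^{(i+1)−(K+1)}`, hence common to the two runs. [cite: Balaban1985UV3, (24) p.262] -/
def LocMatched : Prop :=
  ∀ K n : ℕ, n ≤ K → ∀ i : ℕ, 1 ≤ i → i ≤ K - n →
    Set.BijOn (refineSet F K) ↑(D.Loc K (K - n) (D.triv K (K - n)) i) ↑(D.Loc (K + 1) (K + 1 - n) (D.triv (K + 1) (K + 1 - n)) (i + 1))

/-- **THE CUT-OFF-CAUCHY PROPERTY, POLYMER BY POLYMER** (hypothesis schema, never asserted; [King1986] Props 3.8–3.9 + §3.4–3.5 «replacing one by one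
every factor … and bounding the error at each step» read for Bałaban's localised interaction terms (43) at the trivial-history composite minimisers
of two consecutive cut-offs — located, unprinted for non-abelian d = 3): per-polymer budgets `η K j Y ≥ 0` and constants `c K j Y` for the MATCHED
terms (run `K+1`, level `2+j`, domain `refineSet Y` vs run `K`, level `1+j`, domain `Y`, `j < K − ⌊K/m⌋`), a budget `δ₀ K ≥ 0` with constant `c₀ K`
for the `V`-dependence of run `K+1`'s extra finest level, summability of `K ↦ δ₀ K + Σ_{j<K−⌊K/m⌋} Σ_{Y ∈ Loc} η K j Y`, and the a.e. inequalities on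
the `θBal(⌊K/m⌋)`-small data with both restricted height densities positive. [cite: King1986, Prop. 3.8-3.9 pp.664-665] -/
def PolymerCauchyAt (m : ℕ) : Prop :=
  ∃ (η c : (K j : ℕ) → Set (Site (F.P K) 0) → ℝ) (δ₀ c₀ : ℕ → ℝ),
    (∀ K j Y, 0 ≤ η K j Y) ∧ (∀ K, 0 ≤ δ₀ K) ∧
    (Summable fun K : ℕ => δ₀ K +
      ∑ j ∈ Finset.range (K - K / m), ∑ Y ∈ D.Loc K (K - K / m) (D.triv K (K - K / m)) (1 + j), η K j Y) ∧
    (∀ K, ∀ᵐ V ∂fieldMeasure (F.P (K / m)) 0 (Matrix.specialUnitaryGroup (Fin 2) ℂ),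
      PlaqSmall (θBal F.L γ b₀ p₀ (K / m)) V →
        0 < heightDensity F γ (Nat.div_le_self K m) (histGood F ℰp (θBal F.L γ b₀ p₀) K (K / m)) V →
        0 < heightDensity F γ ((Nat.div_le_self K m).trans (Nat.le_succ K))
              (histGood F ℰp (θBal F.L γ b₀ p₀) (K + 1) (K / m)) V →
          |(∑ Y ∈ D.Loc (K + 1) (K + 1 - K / m) (D.triv (K + 1) (K + 1 - K / m)) 1,
              D.Pterm (K + 1) 1 Y (D.Umin (K + 1) (K + 1 - K / m) (D.triv (K + 1) (K + 1 - K / m))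
                (fieldShift (F.sitesPerDir_eq (m := F.m) (K := K + 1) (j := K + 1 - K / m) (m' := F.m) (K' := K / m) (j' := 0) (by have := Nat.div_le_self K m; omega)) V))) -
            c₀ K| ≤ δ₀ K) ∧
    (∀ K, ∀ j < K - K / m, ∀ Y ∈ D.Loc K (K - K / m) (D.triv K (K - K / m)) (1 + j),
      ∀ᵐ V ∂fieldMeasure (F.P (K / m)) 0 (Matrix.specialUnitaryGroup (Fin 2) ℂ),
        PlaqSmall (θBal F.L γ b₀ p₀ (K / m)) V →
          0 < heightDensity F γ (Nat.div_le_self K m) (histGood F ℰp (θBal F.L γ b₀ p₀) K (K / m)) V →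
          0 < heightDensity F γ ((Nat.div_le_self K m).trans (Nat.le_succ K))
                (histGood F ℰp (θBal F.L γ b₀ p₀) (K + 1) (K / m)) V →
            |D.Pterm (K + 1) (1 + (j + 1)) (refineSet F K Y) (D.Umin (K + 1) (K + 1 - K / m) (D.triv (K + 1) (K + 1 - K / m))
                (fieldShift (F.sitesPerDir_eq (m := F.m) (K := K + 1) (j := K + 1 - K / m) (m' := F.m) (K' := K / m) (j' := 0) (by have := Nat.div_le_self K m; omega)) V)) -
              D.Pterm K (1 + j) Y (D.Umin K (K - K / m) (D.triv K (K - K / m))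
                (fieldShift (F.sitesPerDir_eq (m := F.m) (K := K) (j := K - K / m) (m' := F.m) (K' := K / m) (j' := 0) (by have := Nat.div_le_self K m; omega)) V)) -
              c K j Y| ≤ η K j Y)

end Schemas

end Literature.MathematicalPhysics.QuantumFieldTheory.Balaban1983to89.T3AlphaPolymerSocket

end
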